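import Literature.MathematicalPhysics.QuantumFieldTheory.Balaban1983to89.Node00.TorusCoverCubeDomains
import Summits.QuantumFields.YangMills.Theorems.UnitScaleTiltProp8FlatCubeOpsText
import Summits.QuantumFields.YangMills.Theorems.UnitScaleTiltProp8FlatPortChart
import HarnessLib

/-!
# K0⁷ `stub_prop8StepCoP13` (stmt-QuantumFields-20541), sub-target S5 — **THE CORE COLLAR (144) OF THE `CubeB8` DATUM'S TORUS FAMILY IN THE PHYSICAL DISTANCE**:
# for dag-n07-e's `cubeDomains P a M ρ k hk` ([Balaban1985RegularSpaces] (1.131)'s tower pushed through the level covers, module 39) and every observation bond `b`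
# BASED IN THE WINDOW `□ = π '' box`, every lower-level index bond `c` (`j(c) < k`) satisfies `ρ ≤ distBI(b, c)` — the hypothesis `hcollar` of the repaired S5 socket
# `K0S5HBRows164CoreCubeSeq.hbRows164_core_of_adm22_T4` (P12, p601600) at the S6 HEAD's own inhabitant of (144) (dag-n07-w4 INTENT-5 `…N07LocalLettersHBSummand`)

Cell `pub-ymgap`, width seat `pub-ymgap-k0-s1-w3` gen 3 (D-0149; bus CLAIM∕INTENT-3 INBOX l.28186; dag-n07-w4's ask I.27845∕I.28031).  `--kind proof --supports stmt-QuantumFields-20541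
--as helper`; count-neutral; def-free.  CONSUMED BY NAME, nothing restated: module 39 `Node00.TorusCoverCubeDomains` (`cubeDomains`, `mem_cubeDomains_Om_iff`,
`blockMap_inBox_of_mem_cube`), module 38 `Node00.TorusCoverLevels` (`coverAt`, `iterBlockOf_cover`), n05-a's `B8Eq131Cubes` (`box`, `box_subset_cube`, `gs`, `gs_succ`,
`sqLo`, `sqHi`, `bLo`, `bHi`), UST `FlatCubeOpsText.distBI` and `FlatPortChart.mul_distSite_blockOf_le`.

THE PRINT ([Balaban1985Variational] (144) p. 300): *«□₀ ⊃ □₁ ⊃ … ⊃ □_k ⊃ □, dist(□_{n+1}, □_nᶜ) = R₁M₁Lⁿη, n = 0, 1, …, k»* — at `n = k` this is the INNERMOST collar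
`dist(□, □_kᶜ) = R₁M₁L^kη = R₁M₁` (unit scale), and [Balaban1985RegularSpaces] (1.131) p. 99: *«Λ′_j = □_j^{(j)} ∖ □_{j+1}^{(j)}»*, p. 98: *«a distance between boundaries of these
cubes is equal to R₁M₁Lʲη»* — so `□_{j+1}^{(j)} ⊇ □^{(j)}` with margin `R₁M₁·Σ_{i=j+1}^{k} L^{i−j} ≥ R₁M₁L^{k−j}` (n05-a: `ρ·(gs L (k−j) − 1)`, `ρ = R₁M₁`), and every cell of `Λ′_j`,
`j < k`, is `≥ R₁M₁` away from `□` in the unit-scale distance `L^{j−k}·dist_j` of (161).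

WHAT IS PROVED (sorry-free; axioms standard; no definition), for every `P : Params`, corner `a`, side `M`, collar `ρ`, depth `k ≤ m + K`:
* §1 `pow_le_gs` (`Lⁿ ≤ gs L n`); `exists_coverAt_lift_near` — THE TORUS LIFT: for a label `u : ℤᵈ` and a site `y` of `T^{(n)}` there is a lift `z`, `π_n z = y`, with
  `|u_μ − z_μ| ≤ dist_n(π_n u, y)` coordinatewise (take `z_μ = u_μ − valMinAbs(π_n u_μ − y_μ)`); `blockMap_box_bounds` (`x ∈ □ ⇒ L^{k−n}a ≤ ⌊x∕Lⁿ⌋ ≤ L^{k−n}(a + M) − 1`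
  coordinatewise, from `box_subset_cube` at collar `0` and module 39's `blockMap_inBox_of_mem_cube`).
* §2 ★ `succ_le_distSite_of_not_deep` — a level-`j` site `y′` that is NOT DEEP for `cubeDomains` (`blockOf y′ ∉ Ω_{j+1}^{(j+1)} = π_{j+1} '' [sqLo (j+1), sqHi (j+1)]`, `j + 1 ≤ k`)
  is far from the window: `ρ·gs L (k−j−1) + 1 ≤ dist_{j+1}(B^{j+1}(π x), blockOf y′)` for every `x ∈ □` (no lift of `blockOf y′` lies in the margin-`ρ·gs` label box, while
  `⌊x∕L^{j+1}⌋` lies in the margin-`0` one).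
* §3 ★★ `le_distBI_cubeDomains_of_mem_box` — for `b₋ = π x`, `x ∈ box P.L a M k`, and every index bond `c` of `cubeDomains P a M ρ k hk` with `j(c) < k`:
  `(ρ : ℝ) ≤ distBI (cubeDomains P a M ρ k hk) b c`; ★★ `hcollar_cubeDomains` — the window form `∀ b, b.src ∈ cover P '' box P.L a M k → ∀ c, j(c) < k → ρ ≤ distBI … b c`
  (= P12's `hcollar` with `R′ := ρ`, hence its smallness reads `8C_d·C·B₃·e^{−δ₁ρ} ≤ θ`: «R₁M₁ sufficiently big», `K0S5HBRows164CoreCubeSeq.exists_collar_threshold`).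
NO non-wrapping ∕ injectivity hypothesis is needed (non-deepness already says «no lift in the box»).
HONEST FRAMING: lattice geometry only; nothing of [15]∕[6]∕[B6] analysis asserted; `Adm22 (cubeDomains …)` is n07-e's 39b, not here; K0⁷ OPEN; N07 NOT discharged (5∕27
unmoved); one finite 𝕋⁴ programme at fixed ε — R4 closes the conditional finite-𝕋⁴ rung `BalabanLadder.UV` only; the YM mass gap (Clay) is NOT proved by any of this; nothing
continuum ∕ ℝ⁴ ∕ OS.

References: T. Bałaban, CMP **102** (1985) 277–309 [Balaban1985Variational] (144) p.300, (161) p.303; CMP **102** (1985) 255–275 [Balaban1985RegularSpaces] p.98, (1.131)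
p.99; CMP **96** (1984) 223–250 [Balaban1984PropagatorsII] (2.3) p.224; CMP **109** (1987) 249–301 [Balaban1987RG1] (0.1) p.251.
-/

set_option autoImplicit false

noncomputable section

namespace Summit.QuantumFields.YangMills.Theorems.K0S5CollarCubeDomains

open Literature.MathematicalPhysics.QuantumFieldTheory.Balaban1983to89
open Literature.MathematicalPhysics.QuantumFieldTheory.Balaban1983to89.Node00 (coverAt coverAt_apply coverAt_zero iterBlockOf_cover cubeDomains cubeDomains_k
  mem_cubeDomains_Om_iff blockMap_inBox_of_mem_cube)
open Literature.MathematicalPhysics.QuantumLattice (blockMap)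
open B15Eq112TorusCover (cover)
open B14DomainGeom (Pt)
open B5Eq117TorusCarriers (Mk)
open B5Eq118OneStroke (iterBlockOf iterBlockOf_succ)
open B5Prop12FieldsLattice (distSite distSite_nonneg)
open B6SectADomainsV1 (Domains)
open B6SectAOperatorsV1 (BondIdx)
open B7Prop1Local (InBox)
open B8Eq131Cubes (box box_subset_cube gs gs_succ sqLo sqHi bLo bHi)
open FlatCubeOpsText (distBI)
open FlatPortChart (mul_distSite_blockOf_le)

variable {P : Params}

/-! ## §1 Plumbing: the geometric sum, the torus lift, the block labels of the window -/

/-- `Lⁿ ≤ gs L n = Σ_{i ≤ n} Lⁱ`. [folklore] -/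
theorem pow_le_gs (L n : ℕ) : L ^ n ≤ gs L n :=
  Finset.single_le_sum (f := fun i => L ^ i) (fun _ _ => Nat.zero_le _) (Finset.self_mem_range_succ n)

/-- **THE TORUS LIFT NEAR A LABEL**: every site `y` of `T^{(n)}` has a lift `z ∈ ℤᵈ`, `π_n z = y`, within the torus sup-distance of any given label `u`:
`|u_μ − z_μ| ≤ dist_n(π_n u, y)` for all `μ`. [cite: Balaban1987RG1, (0.1) p.251, bookkeeping] -/
theorem exists_coverAt_lift_near (n : ℕ) (u : Pt P.d) (y : Site P n) :
    ∃ z : Pt P.d, coverAt P n z = y ∧ ∀ μ, ((u μ - z μ).natAbs : ℝ) ≤ distSite (Mk P n) (coverAt P n u) y := by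
  refine ⟨fun μ => u μ - ((coverAt P n u μ - y μ).valMinAbs : ℤ), ?_, fun μ => ?_⟩
  · funext μ
    simp only [coverAt_apply, Int.cast_sub, ZMod.coe_valMinAbs, sub_sub_cancel]
  · have h1 : (u μ - (u μ - ((coverAt P n u μ - y μ).valMinAbs : ℤ))).natAbs = ((coverAt P n u μ - y μ).valMinAbs).natAbs := by
      rw [sub_sub_cancel]
    rw [h1]
    unfold distSite
    exact_mod_cast Finset.le_sup (f := fun μ : Fin P.d => ((coverAt P n u μ - y μ).valMinAbs).natAbs) (Finset.mem_univ μ)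

/-- **THE BLOCK LABELS OF THE WINDOW**: for `x ∈ □ = [Lᵏa, Lᵏ(a + M) − 1]` and `n ≤ k`, `⌊x∕Lⁿ⌋ ∈ [L^{k−n}a, L^{k−n}(a + M) − 1]` coordinatewise (the margin-`0` box of depth `k − n`).
[cite: Balaban1985RegularSpaces, p.98 («we take a size of □ equal to MLʲη»)] -/
theorem blockMap_box_bounds {a : Pt P.d} {M k n : ℕ} (hn : n ≤ k) {x : Pt P.d} (hx : x ∈ box P.L a M k) (μ : Fin P.d) :
    (P.L : ℤ) ^ (k - n) * a μ ≤ blockMap (P.L ^ n) x μ ∧ blockMap (P.L ^ n) x μ ≤ (P.L : ℤ) ^ (k - n) * (a μ + M) - 1 := by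
  have hx' : x ∈ B8Eq131Cubes.cube P.L a M 0 k n := box_subset_cube hn hx
  have h := blockMap_inBox_of_mem_cube hx' μ
  simp only [sqLo, sqHi, bLo, bHi, zero_mul, Nat.cast_zero, sub_zero, add_zero] at h
  exact h

/-! ## §2 A non-deep site is far from the window -/

section Collar

variable {a : Pt P.d} {M ρ k : ℕ} {hk : k ≤ P.m + P.K}

/-- ★ **A NON-DEEP LEVEL-`j` SITE IS `ρ·gs(k−j−1) + 1` AWAY FROM THE WINDOW AT LEVEL `j + 1`**: if `blockOf y′ ∉ Ω_{j+1}^{(j+1)}` of `cubeDomains P a M ρ k hk` (`j + 1 ≤ k`) then for every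
`x ∈ □`: `ρ·gs L (k − j − 1) + 1 ≤ dist_{j+1}(B^{j+1}(π x), blockOf y′)` — a lift of `blockOf y′` within `ρ·gs` of `⌊x∕L^{j+1}⌋ ∈ □^{(j+1)}` would lie in the label box
`[sqLo (j+1), sqHi (j+1)]`, contradicting non-deepness. [cite: Balaban1985RegularSpaces, (1.131) p.99, p.98; Balaban1985Variational, (144) p.300] -/
theorem succ_le_distSite_of_not_deep {j : ℕ} (hjk : j + 1 ≤ k) {y' : Site P j} (hy' : blockOf y' ∉ (cubeDomains P a M ρ k hk).Om (j + 1))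
    {x : Pt P.d} (hx : x ∈ box P.L a M k) :
    (ρ : ℝ) * gs P.L (k - (j + 1)) + 1 ≤ distSite (Mk P (j + 1)) (iterBlockOf (j + 1) (cover P x)) (blockOf y') := by
  have hj1 : j + 1 ≤ P.m + P.K := hjk.trans hk
  rw [iterBlockOf_cover hj1 x]
  set u : Pt P.d := blockMap (P.L ^ (j + 1)) x with hu
  obtain ⟨z, hz, hnear⟩ := exists_coverAt_lift_near (P := P) (j + 1) u (blockOf y')
  -- `z` is not in the label box of `Ω_{j+1}`
  have hzout : ¬ InBox (sqLo P.L a ρ k (j + 1)) (sqHi P.L a M ρ k (j + 1)) z := by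
    intro hzin
    exact hy' ((mem_cubeDomains_Om_iff (by omega) hjk _).2 ⟨z, hzin, hz⟩)
  -- hence some coordinate of `z` is outside the margin-`ρ·gs` interval, while `u` is inside the margin-`0` one
  simp only [InBox, not_forall, not_and_or, not_le] at hzout
  obtain ⟨μ, hμ⟩ := hzout
  obtain ⟨hu1, hu2⟩ := blockMap_box_bounds hjk hx μ
  rw [← hu] at hu1 hu2
  have hm : ((ρ * gs P.L (k - (j + 1)) : ℕ) : ℤ) + 1 ≤ ((u μ - z μ).natAbs : ℤ) := by
    simp only [sqLo, sqHi, bLo, bHi] at hμ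
    rcases hμ with h | h
    · -- `z μ < L^{k-j-1} a μ − ρ·gs`
      have h' : ((ρ * gs P.L (k - (j + 1)) : ℕ) : ℤ) + 1 ≤ u μ - z μ := by push_cast at h ⊢; linarith
      exact h'.trans Int.le_natAbs
    · have h' : ((ρ * gs P.L (k - (j + 1)) : ℕ) : ℤ) + 1 ≤ -(u μ - z μ) := by push_cast at h ⊢; linarith
      exact h'.trans (by rw [← Int.natAbs_neg]; exact Int.le_natAbs)
  have hmR : (ρ : ℝ) * gs P.L (k - (j + 1)) + 1 ≤ ((u μ - z μ).natAbs : ℝ) := by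
    have h2 : ((ρ * gs P.L (k - (j + 1)) + 1 : ℕ) : ℤ) ≤ ((u μ - z μ).natAbs : ℤ) := by push_cast at hm ⊢; exact hm
    have h3 : (ρ * gs P.L (k - (j + 1)) + 1 : ℕ) ≤ (u μ - z μ).natAbs := by exact_mod_cast h2
    have h4 : ((ρ * gs P.L (k - (j + 1)) + 1 : ℕ) : ℝ) ≤ ((u μ - z μ).natAbs : ℝ) := by exact_mod_cast h3
    push_cast at h4
    exact h4
  exact hmR.trans (hnear μ)

/-! ## §3 The core collar in the physical distance `distBI` -/

/-- ★★ **THE CORE COLLAR OF (144) AT THE DATUM'S TORUS FAMILY, IN THE PHYSICAL DISTANCE**: for `b₋ = π x` with `x ∈ □ = box P.L a M k` and every index bond `c` of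
`cubeDomains P a M ρ k hk` at a level `j(c) < k`: `ρ ≤ distBI(b, c)` — `c₋` is not deep ([B6] (2.3)), so §2 gives `dist_{j+1}(B^{j+1}b₋, B(c₋)) ≥ ρ·gs(k−j−1) + 1`; one level down costs
a factor `L` and `L − 1` (`FlatPortChart.mul_distSite_blockOf_le`); the scaling `L^{j−k}` of (161)'s distance and `gs(k−j−1) ≥ L^{k−j−1}` return `ρ`.
[cite: Balaban1985Variational, (144) p.300, (161) p.303; Balaban1985RegularSpaces, (1.131) p.99; Balaban1984PropagatorsII, (2.3) p.224] -/
theorem le_distBI_cubeDomains_of_mem_box {x : Pt P.d} (hx : x ∈ box P.L a M k) {b : PBond P 0} (hb : b.src = cover P x)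
    (c : BondIdx (cubeDomains P a M ρ k hk)) (hc : (c.1.1 : ℕ) < k) :
    (ρ : ℝ) ≤ distBI (cubeDomains P a M ρ k hk) b c := by
  set j : ℕ := (c.1.1 : ℕ) with hj
  obtain ⟨i, hi⟩ : ∃ i : ℕ, k = j + 1 + i := ⟨k - j - 1, by omega⟩
  have hjk : j + 1 ≤ k := by omega
  have hj1 : j + 1 ≤ P.m + P.K := hjk.trans hk
  have hL1 : (1 : ℝ) ≤ P.L := by exact_mod_cast P.L_pos
  have hL0 : (0 : ℝ) ≤ P.L := by linarith
  -- (1) the index bond is not deep; §2 at level `j + 1`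
  have hnd : blockOf c.1.2.src ∉ (cubeDomains P a M ρ k hk).Om (j + 1) := c.2.2.1
  have h2 := succ_le_distSite_of_not_deep (hk := hk) hjk hnd hx
  rw [← hb] at h2
  -- (2) one level down
  have hdown := mul_distSite_blockOf_le hj1 (iterBlockOf j b.src) c.1.2.src
  have hsucc : blockOf (iterBlockOf j b.src) = iterBlockOf (j + 1) b.src := rfl
  rw [hsucc] at hdown
  have hki : k - (j + 1) = i := by omega
  rw [hki] at h2
  -- `dist_j ≥ L·(ρ·gs i + 1) − (L − 1) = L·ρ·gs i + 1`
  have hlevj : (P.L : ℝ) * ((ρ : ℝ) * gs P.L i) + 1 ≤ distSite (Mk P j) (iterBlockOf j b.src) c.1.2.src := by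
    have := mul_le_mul_of_nonneg_left h2 hL0
    linarith
  -- (3) `gs i ≥ Lⁱ`, so `L·ρ·gs i ≥ ρ·L^{i+1}`
  have hgs : (P.L : ℝ) ^ i ≤ (gs P.L i : ℝ) := by exact_mod_cast pow_le_gs P.L i
  have hρ0 : (0 : ℝ) ≤ ρ := Nat.cast_nonneg _
  have hmain : (ρ : ℝ) * (P.L : ℝ) ^ (i + 1) ≤ distSite (Mk P j) (iterBlockOf j b.src) c.1.2.src := by
    have h1 : (ρ : ℝ) * (P.L : ℝ) ^ (i + 1) ≤ (P.L : ℝ) * ((ρ : ℝ) * gs P.L i) := by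
      rw [pow_succ]
      have := mul_le_mul_of_nonneg_left hgs hρ0
      nlinarith
    linarith
  -- (4) the scaling of `distBI`
  have hkj : (cubeDomains P a M ρ k hk).k - (c.1.1 : ℕ) = i + 1 := by
    show k - j = i + 1
    omega
  unfold distBI
  rw [hkj, inv_pow, le_inv_mul_iff₀ (by positivity : (0 : ℝ) < (P.L : ℝ) ^ (i + 1))]
  linarith

/-- ★★ **THE WINDOW FORM** (= the hypothesis `hcollar` of `K0S5HBRows164CoreCubeSeq.hbRows164_core_of_adm22_T4` at `D := cubeDomains P a M ρ k hk` with `R′ := ρ`): every bond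
based in the window `π '' □` and every index bond of level `< k` are `≥ ρ` apart in the physical distance. [cite: Balaban1985Variational, (144) p.300, (161) p.303; Balaban1985RegularSpaces, (1.131) p.99] -/
theorem hcollar_cubeDomains :
    ∀ b : PBond P 0, b.src ∈ cover P '' box P.L a M k →
      ∀ c : BondIdx (cubeDomains P a M ρ k hk), (c.1.1 : ℕ) < k → (ρ : ℝ) ≤ distBI (cubeDomains P a M ρ k hk) b c := by
  intro b hb c hc
  obtain ⟨x, hx, hbx⟩ := hb
  exact le_distBI_cubeDomains_of_mem_box hx hbx.symm c hc

end Collar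

end Summit.QuantumFields.YangMills.Theorems.K0S5CollarCubeDomains

end
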